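import Summits.KontsevichZagierPeriods.KontsevichZagierPeriods.Theses.HurwitzMicroSectors
import Literature.NumberTheory.Transcendental.KZLogCalculusProofs
import Literature.NumberTheory.Transcendental.KZProductIdeal
import Literature.NumberTheory.Transcendental.KZSemialgebraicComplex

/-!
# `HurwitzSectorComplement` (stmt-KontsevichZagierPeriods-14341, route HurwitzMicroSectors),
# line `chebyshev-level-deformation`: stub `stub_arcDissection` (S3) — auxiliary file

Toolkit for the two arc dissections of `…StubArcDissection.lean`, over the order simplices
`Δ k V = {v : ℝᵏ | V > v₀ > ⋯ > v_{k−1} > 0}` (given abstractly through the membership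
characterisation `v ∈ Δ k V ↔ StrictAnti (Fin.cons V v) ∧ 0 < (Fin.cons V v) (Fin.last k)`) with
the symmetric weight `∏ g(vᵢ)`, `g(v) = 2/(1+v²)`, `V > 0` real-algebraic:

* `mem_Δ_iff` — the cons-free description (`StrictAnti v`, all entries in `(0, V)`);
* `strictAnti_iff_succAbove`, `comp_mem_Δ_iff` — the INSERTION CELLS: for the permutation `e`
  with `e p = last`, `e (p.succAbove i) = castSucc i` (`exists_insPerm`), `w ∘ e ∈ Δ (k+1) V` iff
  the first `k` coordinates lie in `Δ k V`, the last one in `(0, V)`, strictly between its chain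
  neighbours at position `p`; the cells are pairwise disjoint (`eq_of_cellCond`) and cover
  everything off the tie walls `{w_last = wᵢ}` (`exists_cellCond`), which are Lebesgue-null
  (`volume_walls`, `Measure.addHaar_submodule`);
* `isSemialgebraic_Δ`, `exists_simplexRep`, `exists_rayRep` — the representations
  `[Δ k V, ∏ g]` and `[(V, ∞), g]` exist (`ℚ`-semialgebraic domains with the real-algebraic
  constant `V`, `isSemialgebraicFunOn_const_of_isAlgebraic`; the integrand is `2ᵏ/∏(1+vᵢ²)`,
  `KZ.graphWeight`, integrable on all of `ℝᵏ`, `KZ.integrable_graphWeight_inv`).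

References: M. Kontsevich, D. Zagier, *Periods* (2001), §1.1 (semialgebraic data with algebraic
constants), §1.2 rules (1), (2).
-/

noncomputable section

open Set MeasureTheory
open scoped BigOperators
open Literature.NumberTheory.Transcendental

namespace Summit.KontsevichZagierPeriods.Theorems.HurwitzMicroSectorsHurwitzSectorComplement

namespace ArcDissection

open Literature.ModelTheory.ExponentialFields (IsSemialgebraic isSemialgebraic_univ
  isSemialgebraic_setOf_eval_pos)

variable {Δ : (m : ℕ) → ℝ → Set (Fin m → ℝ)} {V : ℝ}

/-- The order simplex `Δ k V = {V > v₀ > ⋯ > v_{k-1} > 0}`, cons-free: a strictly decreasing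
tuple with all entries in `(0, V)`. [folklore] -/
theorem mem_Δ_iff
    (hΔ : ∀ m V v, v ∈ Δ m V ↔ StrictAnti (Fin.cons V v : Fin (m + 1) → ℝ) ∧
      0 < (Fin.cons V v : Fin (m + 1) → ℝ) (Fin.last m))
    (hV : 0 < V) {k : ℕ} (v : Fin k → ℝ) :
    v ∈ Δ k V ↔ StrictAnti v ∧ ∀ i, 0 < v i ∧ v i < V := by
  rw [hΔ]
  cases k with
  | zero =>
    have h1 : StrictAnti (Fin.cons V v : Fin 1 → ℝ) := fun a b h => by
      exfalso
      have ha := a.isLt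
      have hb := b.isLt
      exact absurd (Fin.lt_def.1 h) (by omega)
    have h2 : StrictAnti v := fun a => a.elim0
    simp [h1, h2, hV]
  | succ k =>
    have h1 : StrictAnti (Fin.cons V v : Fin (k + 2) → ℝ) ↔ v 0 < V ∧ StrictAnti v :=
      strictAnti_vecCons
    have h2 : (Fin.cons V v : Fin (k + 2) → ℝ) (Fin.last (k + 1)) = v (Fin.last k) := by
      rw [← Fin.succ_last, Fin.cons_succ]
    rw [h1, h2]
    constructor
    · rintro ⟨⟨h0, hv⟩, hl⟩
      exact ⟨hv, fun i => ⟨hl.trans_le (hv.antitone (Fin.le_last i)),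
        (hv.antitone (Fin.zero_le i)).trans_lt h0⟩⟩
    · rintro ⟨hv, hb⟩
      exact ⟨⟨(hb 0).2, hv⟩, (hb _).1⟩

/-- Sorting a tuple with one entry singled out: `u` is strictly decreasing iff it is so away
from position `p`, the entries before `p` exceed `u p`, and those after `p` are below `u p`.
[folklore] -/
theorem strictAnti_iff_succAbove {k : ℕ} (u : Fin (k + 1) → ℝ) (p : Fin (k + 1)) :
    StrictAnti u ↔ StrictAnti (fun i => u (p.succAbove i)) ∧
      (∀ i, Fin.castSucc i < p → u p < u (p.succAbove i)) ∧
      (∀ i, p ≤ Fin.castSucc i → u (p.succAbove i) < u p) := by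
  constructor
  · intro hu
    refine ⟨hu.comp_strictMono (Fin.strictMono_succAbove p), fun i hi => hu ?_, fun i hi => hu ?_⟩
    · exact (Fin.succAbove_lt_iff_castSucc_lt p i).2 hi
    · exact (Fin.lt_succAbove_iff_le_castSucc p i).2 hi
  · rintro ⟨h1, h2, h3⟩ a b hab
    rcases Fin.eq_self_or_eq_succAbove p a with ha | ⟨i, hi⟩ <;>
      rcases Fin.eq_self_or_eq_succAbove p b with hb | ⟨j, hj⟩
    · rw [ha, hb] at hab
      exact absurd hab (lt_irrefl _)
    · rw [ha, hj] at hab ⊢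
      exact h3 j ((Fin.lt_succAbove_iff_le_castSucc p j).1 hab)
    · rw [hi, hb] at hab ⊢
      exact h2 i ((Fin.succAbove_lt_iff_castSucc_lt p i).1 hab)
    · rw [hi, hj] at hab ⊢
      exact h1 (Fin.succAbove_lt_succAbove_iff.1 hab)

/-- **Membership in an insertion cell.** For a permutation `e` placing the last coordinate at
position `p` (and the others, in order, around it), `w ∘ e ∈ Δ (k+1) V` iff the first `k`
coordinates form a point of `Δ k V`, the last one lies in `(0, V)`, and it sits between its
neighbours in the chain. [folklore] -/
theorem comp_mem_Δ_iff
    (hΔ : ∀ m V v, v ∈ Δ m V ↔ StrictAnti (Fin.cons V v : Fin (m + 1) → ℝ) ∧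
      0 < (Fin.cons V v : Fin (m + 1) → ℝ) (Fin.last m))
    (hV : 0 < V) {k : ℕ} (p : Fin (k + 1)) (e : Equiv.Perm (Fin (k + 1)))
    (hep : e p = Fin.last k) (hes : ∀ i, e (p.succAbove i) = Fin.castSucc i)
    (w : Fin (k + 1) → ℝ) :
    (fun i => w (e i)) ∈ Δ (k + 1) V ↔
      (fun i => w (Fin.castSucc i)) ∈ Δ k V ∧ (0 < w (Fin.last k) ∧ w (Fin.last k) < V) ∧
      (∀ i, Fin.castSucc i < p → w (Fin.last k) < w (Fin.castSucc i)) ∧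
      (∀ i, p ≤ Fin.castSucc i → w (Fin.castSucc i) < w (Fin.last k)) := by
  rw [mem_Δ_iff hΔ hV, mem_Δ_iff hΔ hV, strictAnti_iff_succAbove _ p,
    Fin.forall_iff_succAbove p]
  simp only [hep, hes]
  tauto

/-- Two insertion cells with different positions are disjoint. [folklore] -/
theorem eq_of_cellCond {k : ℕ} {p q : Fin (k + 1)} {w : Fin (k + 1) → ℝ}
    (hp : (∀ i, Fin.castSucc i < p → w (Fin.last k) < w (Fin.castSucc i)) ∧
      (∀ i, p ≤ Fin.castSucc i → w (Fin.castSucc i) < w (Fin.last k)))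
    (hq : (∀ i, Fin.castSucc i < q → w (Fin.last k) < w (Fin.castSucc i)) ∧
      (∀ i, q ≤ Fin.castSucc i → w (Fin.castSucc i) < w (Fin.last k))) : p = q := by
  by_contra hne
  wlog hlt : p < q generalizing p q
  · exact this hq hp (Ne.symm hne) (lt_of_le_of_ne (not_lt.1 hlt) (Ne.symm hne))
  obtain ⟨i, rfl⟩ := Fin.exists_castSucc_eq.2 (Fin.ne_last_of_lt hlt)
  exact lt_asymm (hp.2 i le_rfl) (hq.1 i hlt)

/-- Off the tie hyperplanes every point lies in some insertion cell. [folklore] -/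
theorem exists_cellCond {k : ℕ} {w : Fin (k + 1) → ℝ}
    (hx : StrictAnti (fun i => w (Fin.castSucc i)))
    (hne : ∀ i, w (Fin.last k) ≠ w (Fin.castSucc i)) :
    ∃ p : Fin (k + 1), (∀ i, Fin.castSucc i < p → w (Fin.last k) < w (Fin.castSucc i)) ∧
      (∀ i, p ≤ Fin.castSucc i → w (Fin.castSucc i) < w (Fin.last k)) := by
  classical
  by_cases h : ∃ i, w (Fin.castSucc i) < w (Fin.last k)
  · obtain ⟨i₁, hi₁⟩ := h
    obtain ⟨i₀, hi₀, hmin⟩ := (Finset.univ.filter fun i : Fin k =>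
      w (Fin.castSucc i) < w (Fin.last k)).exists_min_image id ⟨i₁, by simpa using hi₁⟩
    simp only [Finset.mem_filter, Finset.mem_univ, true_and, id] at hi₀ hmin
    refine ⟨Fin.castSucc i₀, fun i hi => ?_, fun i hi => ?_⟩
    · have hi' : i < i₀ := Fin.castSucc_lt_castSucc_iff.1 hi
      have : ¬ w (Fin.castSucc i) < w (Fin.last k) := fun h => (not_le.2 hi') (hmin i h)
      exact lt_of_le_of_ne (not_lt.1 this) (hne i)
    · have hi' : i₀ ≤ i := Fin.castSucc_le_castSucc_iff.1 hi
      exact (hx.antitone hi').trans_lt hi₀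
  · push Not at h
    exact ⟨Fin.last k, fun i _ => lt_of_le_of_ne (h i) (hne i),
      fun i hi => absurd hi (not_le.2 (Fin.castSucc_lt_last i))⟩

/-- A diagonal hyperplane `{w last = w i}` is Lebesgue-null (a proper linear subspace).
[folklore] -/
theorem volume_setOf_last_eq_castSucc {k : ℕ} (i : Fin k) :
    volume {w : Fin (k + 1) → ℝ | w (Fin.last k) = w (Fin.castSucc i)} = 0 := by
  let L : (Fin (k + 1) → ℝ) →ₗ[ℝ] ℝ :=
    LinearMap.proj (R := ℝ) (φ := fun _ : Fin (k + 1) => ℝ) (Fin.last k) -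
      LinearMap.proj (R := ℝ) (φ := fun _ : Fin (k + 1) => ℝ) (Fin.castSucc i)
  have hL : ∀ y, L y = y (Fin.last k) - y (Fin.castSucc i) := fun y => rfl
  have hset : {w : Fin (k + 1) → ℝ | w (Fin.last k) = w (Fin.castSucc i)} =
      (LinearMap.ker L : Set (Fin (k + 1) → ℝ)) := by
    ext y
    simp [hL, sub_eq_zero]
  rw [hset]
  refine Measure.addHaar_submodule volume (LinearMap.ker L) fun htop => ?_
  have hmem : (Pi.single (Fin.last k) 1 : Fin (k + 1) → ℝ) ∈ LinearMap.ker L :=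
    htop ▸ Submodule.mem_top
  rw [LinearMap.mem_ker, hL, Pi.single_eq_same,
    Pi.single_eq_of_ne (Fin.castSucc_lt_last i).ne, sub_zero] at hmem
  exact one_ne_zero hmem

/-- The tie walls `{w last = V} ∪ ⋃ᵢ {w last = wᵢ}` are Lebesgue-null. [folklore] -/
theorem volume_walls (k : ℕ) (V : ℝ) :
    volume ({w : Fin (k + 1) → ℝ | w (Fin.last k) = V} ∪
      ⋃ i : Fin k, {w : Fin (k + 1) → ℝ | w (Fin.last k) = w (Fin.castSucc i)}) = 0 :=
  measure_union_null (KZ.volume_setOf_last_eq_zero V)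
    (measure_iUnion_null fun i => volume_setOf_last_eq_castSucc i)

/-! ### Semialgebraic pieces with a real-algebraic constant -/

/-- `{z | z i < V}` is `ℚ`-semialgebraic for real-algebraic `V` (the sublevel set of the
semialgebraic function `z ↦ z i − V`). [cite: KontsevichZagier2001, §1.1] -/
theorem isSemialgebraic_setOf_apply_lt {n : ℕ} (hVa : IsAlgebraic ℚ V) (i : Fin n) :
    IsSemialgebraic ℚ {z : Fin n → ℝ | z i < V} := by
  have hf : IsSemialgebraicFunOn ℚ (univ : Set (Fin n → ℝ)) (fun z => z i - V) := by
    have h1 : IsSemialgebraicFunOn ℚ (univ : Set (Fin n → ℝ)) (fun z => z i) :=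
      (isSemialgebraicFunOn_aeval isSemialgebraic_univ (MvPolynomial.X i)).congr
        fun z _ => by simp
    have h2 : IsSemialgebraicFunOn ℚ (univ : Set (Fin n → ℝ)) (fun _ => V) :=
      isSemialgebraicFunOn_const_of_isAlgebraic isSemialgebraic_univ hVa
    exact IsSemialgebraicFunOn.sub_holds h1 h2
  convert hf.isSemialgebraic_sep_neg using 1
  ext z
  simp [sub_neg]

/-- `{z | V < z i}` is `ℚ`-semialgebraic for real-algebraic `V`. [cite: KontsevichZagier2001, §1.1] -/
theorem isSemialgebraic_setOf_lt_apply {n : ℕ} (hVa : IsAlgebraic ℚ V) (i : Fin n) :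
    IsSemialgebraic ℚ {z : Fin n → ℝ | V < z i} := by
  have hf : IsSemialgebraicFunOn ℚ (univ : Set (Fin n → ℝ)) (fun z => V - z i) := by
    have h1 : IsSemialgebraicFunOn ℚ (univ : Set (Fin n → ℝ)) (fun z => z i) :=
      (isSemialgebraicFunOn_aeval isSemialgebraic_univ (MvPolynomial.X i)).congr
        fun z _ => by simp
    have h2 : IsSemialgebraicFunOn ℚ (univ : Set (Fin n → ℝ)) (fun _ => V) :=
      isSemialgebraicFunOn_const_of_isAlgebraic isSemialgebraic_univ hVa
    exact IsSemialgebraicFunOn.sub_holds h2 h1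
  convert hf.isSemialgebraic_sep_neg using 1
  ext z
  simp [sub_neg]

/-- **The order simplex `Δ k V` is `ℚ`-semialgebraic** (finitely many strict polynomial
inequalities `vⱼ < vᵢ`, `0 < vᵢ`, and `vᵢ < V` with `V` real-algebraic).
[cite: KontsevichZagier2001, §1.1] -/
theorem isSemialgebraic_Δ
    (hΔ : ∀ m V v, v ∈ Δ m V ↔ StrictAnti (Fin.cons V v : Fin (m + 1) → ℝ) ∧
      0 < (Fin.cons V v : Fin (m + 1) → ℝ) (Fin.last m))
    (hVa : IsAlgebraic ℚ V) (hV : 0 < V) (k : ℕ) : IsSemialgebraic ℚ (Δ k V) := by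
  have h1 : IsSemialgebraic ℚ {t : Fin k → ℝ | ∀ i, 0 < t i} := by
    have : {t : Fin k → ℝ | ∀ i, 0 < t i} = ⋂ i ∈ (Finset.univ : Finset (Fin k)),
        {t | 0 < MvPolynomial.aeval t (MvPolynomial.X i : MvPolynomial (Fin k) ℚ)} := by
      ext t; simp
    rw [this]
    exact IsSemialgebraic.biInter _ _ fun i _ => isSemialgebraic_setOf_eval_pos (k := ℚ) _
  have h2 : IsSemialgebraic ℚ {t : Fin k → ℝ | ∀ i, t i < V} := by
    have : {t : Fin k → ℝ | ∀ i, t i < V} = ⋂ i ∈ (Finset.univ : Finset (Fin k)),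
        {t | t i < V} := by
      ext t; simp
    rw [this]
    exact IsSemialgebraic.biInter _ _ fun i _ => isSemialgebraic_setOf_apply_lt hVa i
  have h3 : IsSemialgebraic ℚ {t : Fin k → ℝ | StrictAnti t} := by
    have : {t : Fin k → ℝ | StrictAnti t} = ⋂ p ∈ (Finset.univ.filter fun p : Fin k × Fin k =>
        p.1 < p.2), {t | 0 < MvPolynomial.aeval t
          (MvPolynomial.X p.1 - MvPolynomial.X p.2 : MvPolynomial (Fin k) ℚ)} := by
      ext t
      simp only [mem_setOf_eq, Finset.mem_filter, Finset.mem_univ, true_and, mem_iInter,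
        map_sub, MvPolynomial.aeval_X, sub_pos, Prod.forall]
      exact ⟨fun h a b hab => h hab, fun h a b hab => h a b hab⟩
    rw [this]
    exact IsSemialgebraic.biInter _ _ fun p _ => isSemialgebraic_setOf_eval_pos (k := ℚ) _
  have : Δ k V = {t : Fin k → ℝ | StrictAnti t} ∩ ({t | ∀ i, 0 < t i} ∩ {t | ∀ i, t i < V}) := by
    ext t
    simp only [mem_Δ_iff hΔ hV, mem_inter_iff, mem_setOf_eq, forall_and]
  rw [this]
  exact h3.inter (h1.inter h2)

/-! ### The weight `∏ g(vᵢ)` and the representations it carries -/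

variable {g : ℝ → ℝ}

/-- `∏ᵢ g(vᵢ) = 2ᵏ / ∏ᵢ (1 + vᵢ²)`. [folklore] -/
theorem prod_g_eq (hg : ∀ v, g v = 2 / (1 + v ^ 2)) {k : ℕ} (v : Fin k → ℝ) :
    ∏ i, g (v i) = (2 : ℝ) ^ k * (KZ.graphWeight v)⁻¹ := by
  simp only [hg, div_eq_mul_inv]
  rw [Finset.prod_mul_distrib, Finset.prod_const, Finset.card_univ, Fintype.card_fin,
    Finset.prod_inv_distrib]
  rfl

/-- `v ↦ ∏ᵢ g(vᵢ)` is a `ℚ`-semialgebraic function (a quotient of `ℚ`-polynomials with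
non-vanishing denominator) on every `ℚ`-semialgebraic set. [cite: KontsevichZagier2001, §1.1] -/
theorem isSemialgebraicFunOn_prod_g (hg : ∀ v, g v = 2 / (1 + v ^ 2)) {k : ℕ}
    {σ : Set (Fin k → ℝ)} (hσ : IsSemialgebraic ℚ σ) :
    IsSemialgebraicFunOn ℚ σ (fun v => ∏ i, g (v i)) := by
  refine (isSemialgebraicFunOn_aeval_div_aeval hσ (MvPolynomial.C ((2 : ℚ) ^ k))
    (∏ i, (1 + MvPolynomial.X i ^ 2)) fun x _ => ?_).congr fun x _ => ?_
  · rw [KZ.aeval_prod_one_add_X_sq]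
    exact (KZ.graphWeight_pos x).ne'
  · show MvPolynomial.aeval x (MvPolynomial.C ((2 : ℚ) ^ k)) /
        MvPolynomial.aeval x (∏ i, (1 + MvPolynomial.X i ^ 2)) = ∏ i, g (x i)
    rw [KZ.aeval_prod_one_add_X_sq, prod_g_eq hg, MvPolynomial.aeval_C]
    simp [div_eq_mul_inv]

/-- `v ↦ ∏ᵢ g(vᵢ)` is integrable on `ℝᵏ` (a product of the integrable `2/(1+t²)`).
[cite: KontsevichZagier2001, §1.1] -/
theorem integrable_prod_g (hg : ∀ v, g v = 2 / (1 + v ^ 2)) (k : ℕ) :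
    Integrable (fun v : Fin k → ℝ => ∏ i, g (v i)) := by
  have h := (KZ.integrable_graphWeight_inv (n := k)).const_mul ((2 : ℝ) ^ k)
  exact h.congr (Filter.Eventually.of_forall fun v => (prod_g_eq hg v).symm)

/-- **The simplex representation** `[Δ k V, ∏ g(vᵢ)]` exists in every dimension.
[cite: KontsevichZagier2001, §1.1] -/
theorem exists_simplexRep (hg : ∀ v, g v = 2 / (1 + v ^ 2))
    (hΔ : ∀ m V v, v ∈ Δ m V ↔ StrictAnti (Fin.cons V v : Fin (m + 1) → ℝ) ∧
      0 < (Fin.cons V v : Fin (m + 1) → ℝ) (Fin.last m))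
    (hVa : IsAlgebraic ℚ V) (hV : 0 < V) (k : ℕ) :
    ∃ S : KZ.IntegralRep k, S.domain = Δ k V ∧ S.integrand = fun v => ∏ i, g (v i) :=
  ⟨⟨Δ k V, fun v => ∏ i, g (v i), isSemialgebraic_Δ hΔ hVa hV k,
    isSemialgebraicFunOn_prod_g hg (isSemialgebraic_Δ hΔ hVa hV k),
    (integrable_prod_g hg k).integrableOn⟩, rfl, rfl⟩

/-- **The outer arc** `[(V, ∞), g]` exists. [cite: KontsevichZagier2001, §1.1] -/
theorem exists_rayRep (hg : ∀ v, g v = 2 / (1 + v ^ 2)) (hVa : IsAlgebraic ℚ V) :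
    ∃ t : KZ.IntegralRep 1, t.domain = {y | V < y 0} ∧ t.integrand = fun y => g (y 0) := by
  have hσ : IsSemialgebraic ℚ {y : Fin 1 → ℝ | V < y 0} := isSemialgebraic_setOf_lt_apply hVa 0
  have he : (fun y : Fin 1 → ℝ => ∏ i, g (y i)) = fun y => g (y 0) := by
    funext y; simp
  refine ⟨⟨{y | V < y 0}, fun y => g (y 0), hσ, ?_, ?_⟩, rfl, rfl⟩
  · exact he ▸ isSemialgebraicFunOn_prod_g hg hσ
  · exact (he ▸ integrable_prod_g hg 1).integrableOn

/-! ### Small index bookkeeping -/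

/-- The insertion permutation of position `p`: `p ↦ last`, `p.succAbove i ↦ castSucc i`.
[folklore] -/
theorem exists_insPerm {k : ℕ} (p : Fin (k + 1)) :
    ∃ e : Equiv.Perm (Fin (k + 1)), e p = Fin.last k ∧
      ∀ i, e (p.succAbove i) = Fin.castSucc i :=
  ⟨(finSuccEquiv' p).trans (finSuccEquiv' (Fin.last k)).symm, by simp [finSuccEquiv'_at],
    fun i => by simp [finSuccEquiv'_succAbove, finSuccEquiv'_symm_some, Fin.succAbove_last]⟩

/-- `Fin.natAdd k 0 = Fin.last k` (the single coordinate of the second factor of a product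
`ℝᵏ × ℝ¹` is the last one). [folklore] -/
theorem natAdd_zero_eq_last (k : ℕ) : Fin.natAdd k (0 : Fin 1) = Fin.last k := by
  ext; simp



/-- Transport of a set of tuples along `finCongr`. [folklore] -/
theorem setOf_comp_finCongr_mem {n m : ℕ} (h : n = m) (A : (n : ℕ) → Set (Fin n → ℝ)) :
    {w : Fin m → ℝ | (fun i => w (finCongr h i)) ∈ A n} = A m := by
  subst h
  exact Set.ext fun w => by simp

end ArcDissection

/-- **S3-aux (the simplex and ray representations).** For `g(v) = 2/(1+v²)` and the order
simplices `Δ k V` (`V > 0` real-algebraic), the representations `[Δ k V, ∏ g(vᵢ)]` (every `k`) and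
`[(V, ∞), g]` exist: `ℚ`-semialgebraic domains with an algebraic constant, rational integrand,
absolute convergence. [cite: KontsevichZagier2001, §1.1] -/
theorem stub_arcDissection_aux : ∀ (g : ℝ → ℝ) (Δ : (m : ℕ) → ℝ → Set (Fin m → ℝ)), (∀ v, g v = 2 / (1 + v ^ 2)) → (∀ m V v, v ∈ Δ m V ↔ StrictAnti (Fin.cons V v : Fin (m + 1) → ℝ) ∧ 0 < (Fin.cons V v : Fin (m + 1) → ℝ) (Fin.last m)) → ∀ (V : ℝ), IsAlgebraic ℚ V → 0 < V → (∀ k : ℕ, ∃ S : KZ.IntegralRep k, S.domain = Δ k V ∧ S.integrand = fun v => ∏ i, g (v i)) ∧ (∃ t : KZ.IntegralRep 1, t.domain = {y | V < y 0} ∧ t.integrand = fun y => g (y 0)) :=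
  fun _ _ hg hΔ _ hVa hV =>
    ⟨fun k => ArcDissection.exists_simplexRep hg hΔ hVa hV k, ArcDissection.exists_rayRep hg hVa⟩

end Summit.KontsevichZagierPeriods.Theorems.HurwitzMicroSectorsHurwitzSectorComplement

end
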